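import Mathlib
import HarnessLib
import Summits.Ventures.LatticeQCDFlow.Exactness.U1LeapfrogHMCUniformCertificates
import Summits.Ventures.LatticeQCDFlow.Exactness.JitteredHMCCommonMinorant
import Summits.Ventures.LatticeQCDFlow.Exactness.JitteredHMCReversible
import Summits.Ventures.LatticeQCDFlow.Exactness.SUNJitteredHMCMeasurableLabels
import Summits.Ventures.LatticeQCDFlow.Exactness.SUNOmfJitteredHMC

/-!
# The `U(1)` engine with a CONTINUOUS law of the leapfrog step (`tau_jitter`): the labelled kernel for any law, exact and reversible for every law, ONE Doeblin certificate and convergence from every start whenever the law charges a short interval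

HONEST FRAMING: exact (Metropolis-corrected) sampling algorithms for lattice gauge theory;
figures of merit are autocorrelation/cost numbers at stated couplings and volumes; no
continuum-physics claim.

Venture `LatticeQCDFlow` (cell pub-lqcd), topic `Exactness`, FANOUT row 9 (eng-latcore, GEN-24; the engine's
`u1_2d` HMC path `hmc_trajectory(β, τ, nstep, tau_jitter)`).  NEW WORK of the cell over the tree's
`U1MultiStepLeapfrogHMC.lean` (`u1LeapfrogProposalN`, `u1LeapfrogHMCN`, involution / Liouville),
GEN-24's `U1LeapfrogHMCUniformCertificates.lean` (`u1LeapfrogHMCN_minorised_uniform`: ONE `δ • Haar^{⊗ι} ≤ K_{n,ε}(U,·)`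
for EVERY step `ε ∈ [ε₁, ε₂]` of a short-trajectory window), GEN-22/23's abstract jitter files (`jitterHMC`,
`jitterHMC_exact`, `jitterHMC_isReversible`, `smul_le_jitterHMC_of_common_minorant`,
`jitterHMC_uniformlyErgodic_of_common_minorant`) and GEN-24's labelled-measurability lemmas
(`measurable_uncurry_labelledPow`, `measurable_slice_of_uncurry`).  Nothing is cited as a fact; no number is claimed.

WHY.  The `SU(N)` atomless `tau_jitter` route (`SUNJitteredHMCAtomless`) needs a BOX minorant and the exact-step
machinery; for `U(1)` the tree's short-trajectory minorant is GLOBAL (`δ • Haar ≤ K(U, ·)` for every `U`), and GEN-24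
made its constant uniform over a step window.  So the continuous-jitter story for the `u1_2d` engine closes in one
file: the labelled kernel `u1JitterHMCL` (ANY measurable label space, label ↦ step `ε_l`, increment `g_l`, step count
`N_l`), exact and in detailed balance for EVERY law `η`; and, for a fixed step count `n` with the label = the step,
`K_jit(U, ·) ≥ (η[ε₁, ε₂]·δ) • Haar^{⊗E}` for every `U` — ONE Doeblin constant, geometric convergence in total variation
from EVERY initial law at rate `(1 − η[ε₁,ε₂]δ)^t`, uniqueness of the invariant law, and the `τ_int` bound of every
event — whenever the law of the step charges the window.  No atom is needed (the idealised uniform law has none: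
`UniformJitterLawAtomless`).

## Content

§1 `measurable_uncurry_u1Kick`, `measurable_uncurry_u1Drift`, `measurable_uncurry_u1LeapfrogWord`,
`measurable_uncurry_u1LeapfrogProposalN`, `measurable_jitterMap_u1LeapfrogProposalN` — joint measurability of the
labelled `U(1)` leapfrog proposal `(l, (U, p)) ↦ Ψ^{N_l}_{ε_l, g_l}(U, p)`.
§2 `u1JitterHMCL` (def) — the jittered `U(1)` leapfrog kernel for any label law; `u1JitterHMCL_apply` (η-mixture of
`u1LeapfrogHMCN`); `isMarkovKernel_u1JitterHMCL`; `u1JitterHMCL_invariant` (`e^{−S}·Haar^{⊗ι}`), `_invariant_gibbsLaw`;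
`u1JitterHMCL_isReversible`; `smul_le_u1JitterHMCL_of_minorant` (a global minorant shared over a label set `G`
passes with the factor `η(G)`).
§3 the `u1_2d` engine (torus `(ℤ/L)^d`, continuous representation `ρ`, action `β S_W`, label = the step `ε ∼ η`,
`n` steps, increments `g_ε` jointly measurable): `wilson_u1JitterHMCL_invariant` (EVERY law), `wilson_u1JitterHMCL_isReversible`,
**`wilson_u1JitterHMCL_certificate`** (`η[ε₁,ε₂] ≠ 0`, short window ⇒ ONE `0 < ε' ≤ 1` with `ε' • Haar^{⊗E} ≤ K_jit(U,·)` for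
every `U`), **`wilson_u1JitterHMCL_uniformlyErgodic`** (geometric TV convergence from every start + uniqueness),
**`wilson_u1JitterHMCL_tauInt_setACF_le`** (`τ_int(1_A) ≤ 1/2 + B/(1 − π(A))` for every event).

NOT CLAIMED: the law of the STEP under the code's `tau_jitter` is the image of `uniformJitterLaw τ j` under
`τ' ↦ τ'/nstep` (again of the same form); constants are existential; floating point idealised.
-/

noncomputable section

namespace Summit.Ventures.LatticeQCDFlow.Exactness

open MeasureTheory ProbabilityTheory ProbabilityTheory.Kernel Set Metric Function
open Literature.MathematicalPhysics.QuantumFieldTheory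
open scoped ENNReal NNReal

set_option backward.isDefEq.respectTransparency false

/-! ## §1 Joint measurability of the labelled `U(1)` leapfrog proposal -/

section Measurable

variable {ι : Type*} {Lab : Type*} [MeasurableSpace Lab]
variable {ε : Lab → ℝ} {g : Lab → (ι → Circle) → ι → ℝ} {N : Lab → ℕ}

/-- The labelled kick `(l, (U, p)) ↦ (U, p + g_l(U))` is jointly measurable. -/
theorem measurable_uncurry_u1Kick (hg : Measurable fun q : Lab × (ι → Circle) => g q.1 q.2) :
    Measurable fun q : Lab × ((ι → Circle) × (ι → ℝ)) => kick (g q.1) q.2 := by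
  have h1 : Measurable fun q : Lab × ((ι → Circle) × (ι → ℝ)) => g q.1 q.2.1 :=
    hg.comp (measurable_fst.prodMk (measurable_fst.comp measurable_snd))
  exact (measurable_fst.comp measurable_snd).prodMk ((measurable_snd.comp measurable_snd).add h1)

/-- The labelled drift `(l, (U, p)) ↦ ((e^{i ε_l p_j} U_j)_j, p)` is jointly measurable. -/
theorem measurable_uncurry_u1Drift (hε : Measurable ε) :
    Measurable fun q : Lab × ((ι → Circle) × (ι → ℝ)) => drift (mulDrift (u1ExpDrift (ι := ι) (ε q.1))) q.2 := by
  have hexp : Measurable fun q : Lab × ((ι → Circle) × (ι → ℝ)) => u1ExpDrift (ι := ι) (ε q.1) q.2.2 := by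
    refine measurable_pi_lambda _ fun j => ?_
    exact Circle.exp.continuous.measurable.comp
      ((hε.comp measurable_fst).mul ((measurable_pi_apply j).comp (measurable_snd.comp measurable_snd)))
  exact (hexp.mul (measurable_fst.comp measurable_snd)).prodMk (measurable_snd.comp measurable_snd)

/-- One labelled leapfrog step `(l, z) ↦ (K_l D_l K_l)(z)` is jointly measurable. -/
theorem measurable_uncurry_u1LeapfrogWord (hε : Measurable ε)
    (hg : Measurable fun q : Lab × (ι → Circle) => g q.1 q.2) :
    Measurable fun q : Lab × ((ι → Circle) × (ι → ℝ)) =>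
      palindromicWord [kick (g q.1)] (drift (mulDrift (u1ExpDrift (ι := ι) (ε q.1)))) q.2 := by
  have hK := measurable_uncurry_u1Kick (ι := ι) hg
  have hD := measurable_uncurry_u1Drift (ι := ι) (Lab := Lab) hε
  have h : (fun q : Lab × ((ι → Circle) × (ι → ℝ)) =>
      palindromicWord [kick (g q.1)] (drift (mulDrift (u1ExpDrift (ι := ι) (ε q.1)))) q.2) =
      fun q => kick (g q.1) (drift (mulDrift (u1ExpDrift (ι := ι) (ε q.1))) (kick (g q.1) q.2)) := by
    funext q; rw [palindromicWord_kick_drift, Equiv.Perm.coe_mul, Equiv.Perm.coe_mul]; rfl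
  rw [h]
  exact hK.comp (measurable_fst.prodMk (hD.comp (measurable_fst.prodMk hK)))

/-- **THE LABELLED `n`-STEP `U(1)` PROPOSAL `(l, (U, p)) ↦ Ψ^{N_l}_{ε_l, g_l}(U, p)` IS JOINTLY MEASURABLE** (measurable
`ε`, `N`; jointly measurable `g`). -/
theorem measurable_uncurry_u1LeapfrogProposalN (hε : Measurable ε) (hN : Measurable N)
    (hg : Measurable fun q : Lab × (ι → Circle) => g q.1 q.2) :
    Measurable fun q : Lab × ((ι → Circle) × (ι → ℝ)) => u1LeapfrogProposalN (ε q.1) (g q.1) (N q.1) q.2 := by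
  have hW := measurable_uncurry_u1LeapfrogWord (ι := ι) hε hg
  have hP := measurable_uncurry_labelledPow (Lab := Lab)
    (f := fun l => ⇑(palindromicWord [kick (g l)] (drift (mulDrift (u1ExpDrift (ι := ι) (ε l)))))) hW hN
  have h : (fun q : Lab × ((ι → Circle) × (ι → ℝ)) => u1LeapfrogProposalN (ε q.1) (g q.1) (N q.1) q.2) =
      fun q => flip ((⇑(palindromicWord [kick (g q.1)] (drift (mulDrift (u1ExpDrift (ι := ι) (ε q.1))))))^[N q.1] q.2) := by
    funext q; rw [u1LeapfrogProposalN, Equiv.Perm.coe_mul, Equiv.Perm.coe_pow]; rfl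
  rw [h]
  exact measurable_flip.comp hP

/-- Hence the jittered proposal on the enlarged phase space is measurable. -/
theorem measurable_jitterMap_u1LeapfrogProposalN (hε : Measurable ε) (hN : Measurable N)
    (hg : Measurable fun q : Lab × (ι → Circle) => g q.1 q.2) :
    Measurable (jitterMap fun l => ⇑(u1LeapfrogProposalN (ε l) (g l) (N l))) :=
  measurable_jitterMap (measurable_uncurry_u1LeapfrogProposalN hε hN hg)

end Measurable

/-! ## §2 The jittered `U(1)` leapfrog kernel for an arbitrary label law -/

section Kernel

variable {ι : Type*} [Fintype ι] {Lab : Type*} [MeasurableSpace Lab]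
variable {ε : Lab → ℝ} (hε : Measurable ε) {g : Lab → (ι → Circle) → ι → ℝ}
  (hg : Measurable fun q : Lab × (ι → Circle) => g q.1 q.2) (κ : ℝ) (S : (ι → Circle) → ℝ) {N : Lab → ℕ}
  (hN : Measurable N) (η : Measure Lab)

/-- **THE JITTERED `U(1)` LEAPFROG HMC KERNEL FOR AN ARBITRARY LABEL SPACE**: refresh `p ∼ Z⁻¹e^{−T_κ}` and an
independent label `l ∼ η`, run `N_l` P-first leapfrog steps of size `ε_l` with increment `g_l`, flip, Metropolis test
on `S + T_κ`, forget `(p, l)`. -/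
def u1JitterHMCL : Kernel (ι → Circle) (ι → Circle) :=
  jitterHMC (fun l => ⇑(u1LeapfrogProposalN (ε l) (g l) (N l))) (measurable_jitterMap_u1LeapfrogProposalN hε hN hg)
    S (u1Kinetic κ) η (u1MomentumLaw κ)

variable {hε hg κ S hN η}

/-- **IT IS THE `η`-MIXTURE OF THE FIXED-STEP KERNELS** `u1LeapfrogHMCN ε_l κ g_l S N_l`. -/
theorem u1JitterHMCL_apply [SFinite η] [Fact (0 < κ)] (hS : Measurable S) (U : ι → Circle) {A : Set (ι → Circle)}
    (hA : MeasurableSet A) :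
    u1JitterHMCL hε hg κ S hN η U A =
      ∫⁻ l, u1LeapfrogHMCN (ε l) κ (measurable_slice_of_uncurry hg l) S (N l) U A ∂η := by
  rw [u1JitterHMCL, jitterHMC_apply _ _ η _ hS (measurable_u1Kinetic κ) U hA]
  rfl

/-- The kernel is Markov for every probability law `η` and every `κ > 0`. -/
theorem isMarkovKernel_u1JitterHMCL [IsProbabilityMeasure η] (hκ : 0 < κ) (hS : Measurable S) :
    IsMarkovKernel (u1JitterHMCL hε hg κ S hN η) := by
  haveI : Fact (0 < κ) := ⟨hκ⟩
  unfold u1JitterHMCL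
  exact isMarkovKernel_jitterHMC _ _ η _ hS (measurable_u1Kinetic κ)

/-- **EXACT FOR EVERY LAW OF THE LABEL**: the kernel leaves `e^{−S}·Haar^{⊗ι}` invariant for every probability law
`η`, every measurable `S`, every `κ > 0`, every measurable step / increment / step-count assignment. -/
theorem u1JitterHMCL_invariant [IsProbabilityMeasure η] (hκ : 0 < κ) (hS : Measurable S) :
    Invariant (u1JitterHMCL hε hg κ S hN η)
      ((Measure.pi fun _ : ι => haarProbability (Circle)).withDensity fun u => ENNReal.ofReal (Real.exp (-S u))) :=
  jitterHMC_exact (vol := Measure.pi fun _ : ι => haarProbability (Circle)) (volP := volume) η hS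
    (measurable_u1Kinetic κ) (fun l => involutive_u1LeapfrogProposalN (ε l) (N l))
    (fun l => measurePreserving_u1LeapfrogProposalN (ε l) (N l) (measurable_slice_of_uncurry hg l))
    (u1MomentumWeight_univ_ne_zero hκ) (u1MomentumWeight_univ_ne_top hκ)

/-- It leaves the normalised Gibbs law `u1GibbsLaw S` invariant. -/
theorem u1JitterHMCL_invariant_gibbsLaw [IsProbabilityMeasure η] (hκ : 0 < κ) (hS : Measurable S) :
    Invariant (u1JitterHMCL hε hg κ S hN η) (u1GibbsLaw S) :=
  invariant_smul (u1JitterHMCL_invariant hκ hS) _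

/-- **DETAILED BALANCE FOR EVERY LAW OF THE LABEL** w.r.t. `e^{−S}·Haar^{⊗ι}`. -/
theorem u1JitterHMCL_isReversible [IsProbabilityMeasure η] (hS : Measurable S) :
    IsReversible (u1JitterHMCL hε hg κ S hN η)
      ((Measure.pi fun _ : ι => haarProbability (Circle)).withDensity fun u => ENNReal.ofReal (Real.exp (-S u))) :=
  jitterHMC_isReversible (vol := Measure.pi fun _ : ι => haarProbability (Circle)) (volP := volume) η hS
    (measurable_u1Kinetic κ) (fun l => involutive_u1LeapfrogProposalN (ε l) (N l))
    (fun l => measurePreserving_u1LeapfrogProposalN (ε l) (N l) (measurable_slice_of_uncurry hg l))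

/-- **A GLOBAL MINORANT SHARED BY THE FROZEN KERNELS OVER A LABEL SET `G` PASSES TO THE JITTERED KERNEL WITH THE
FACTOR `η(G)`**: `m ≤ K_l(U, ·)` for all `l ∈ G`, all `U` ⇒ `η(G) • m ≤ K_jit(U, ·)` for all `U`. -/
theorem smul_le_u1JitterHMCL_of_minorant [SFinite η] [Fact (0 < κ)] (hS : Measurable S) {G : Set Lab}
    (hG : MeasurableSet G) {m : Measure (ι → Circle)}
    (hm : ∀ l ∈ G, ∀ U, m ≤ u1LeapfrogHMCN (ε l) κ (measurable_slice_of_uncurry hg l) S (N l) U) (U : ι → Circle) :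
    η G • m ≤ u1JitterHMCL hε hg κ S hN η U := by
  have h := smul_le_jitterHMC_of_common_minorant (Φ := fun l => ⇑(u1LeapfrogProposalN (ε l) (g l) (N l)))
    (hΦ := measurable_jitterMap_u1LeapfrogProposalN hε hN hg) (η := η) (μP := u1MomentumLaw κ) hS
    (measurable_u1Kinetic κ) hG (W := Kernel.const (ι → Circle) m) (fun l hl U => by
      rw [Kernel.const_apply]; exact hm l hl U) U
  rwa [Kernel.const_apply] at h

end Kernel

/-! ## §3 The `u1_2d` engine with a general law of the step: exact, reversible, ONE certificate, convergence -/

section Wilson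

variable {d L N : ℕ} (ρ : Circle →* Matrix (Fin N) (Fin N) ℂ)

/-- **EXACT FOR EVERY LAW OF THE STEP**: torus `(ℤ/L)^d`, continuous representation `ρ`, any real `β`, action
`β S_W`, Gaussian momenta `κ > 0`, `n` steps, jointly measurable increments `g_ε`: the jittered kernel leaves
`wilsonMeasure ρ β` invariant for every probability law `η` of the step. -/
theorem wilson_u1JitterHMCL_invariant [NeZero L] (hρ : Continuous ρ) (β : ℝ) {κ : ℝ} (hκ : 0 < κ) (n : ℕ)
    {g : ℝ → GaugeConfig d L Circle → Edge d L → ℝ} (hg : Measurable fun q : ℝ × GaugeConfig d L Circle => g q.1 q.2)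
    (η : Measure ℝ) [IsProbabilityMeasure η] :
    Kernel.Invariant (u1JitterHMCL measurable_id hg κ (fun U : GaugeConfig d L Circle => β * wilsonAction ρ U)
      (N := fun _ => n) measurable_const η) (wilsonMeasure (d := d) (L := L) ρ β) := by
  rw [← u1GibbsLaw_eq_wilsonMeasure (d := d) (L := L) ρ β]
  exact u1JitterHMCL_invariant_gibbsLaw hκ (continuous_smul_wilsonAction ρ hρ β).measurable

/-- **DETAILED BALANCE FOR EVERY LAW OF THE STEP** w.r.t. `wilsonMeasure ρ β`. -/
theorem wilson_u1JitterHMCL_isReversible [NeZero L] (hρ : Continuous ρ) (β : ℝ) (κ : ℝ) (n : ℕ)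
    {g : ℝ → GaugeConfig d L Circle → Edge d L → ℝ} (hg : Measurable fun q : ℝ × GaugeConfig d L Circle => g q.1 q.2)
    (η : Measure ℝ) [IsProbabilityMeasure η] :
    IsReversible (u1JitterHMCL measurable_id hg κ (fun U : GaugeConfig d L Circle => β * wilsonAction ρ U)
      (N := fun _ => n) measurable_const η) (wilsonMeasure (d := d) (L := L) ρ β) := by
  rw [← u1GibbsLaw_eq_wilsonMeasure (d := d) (L := L) ρ β, u1GibbsLaw]
  exact isReversible_smul (u1JitterHMCL_isReversible (continuous_smul_wilsonAction ρ hρ β).measurable) _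

/-- **ONE DOEBLIN CERTIFICATE WHENEVER THE LAW OF THE STEP CHARGES A SHORT WINDOW**: `η[ε₁, ε₂] ≠ 0`, `0 < ε₁ ≤ ε₂`,
`n ≥ 1`, increments `K`-Lipschitz with `4Kε₂n² ≤ 3` and bounded by `b` on the window: the jittered kernel is exact
and ONE `0 < ε' ≤ 1` gives `ε' • Haar^{⊗E} ≤ K_jit(U, ·)` for EVERY configuration `U`. -/
theorem wilson_u1JitterHMCL_certificate [NeZero L] (hρ : Continuous ρ) (β : ℝ) {ε₁ ε₂ κ : ℝ}
    (hε₁ : 0 < ε₁) (h12 : ε₁ ≤ ε₂) (hκ : 0 < κ) {n : ℕ} (hn : 1 ≤ n)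
    {g : ℝ → GaugeConfig d L Circle → Edge d L → ℝ} (hg : Measurable fun q : ℝ × GaugeConfig d L Circle => g q.1 q.2)
    {K : ℝ≥0} (hgK : ∀ ε ∈ Icc ε₁ ε₂, LipschitzWith K (g ε)) (hshort : 4 * (K : ℝ) * ε₂ * (n : ℝ) ^ 2 ≤ 3)
    {b : ℝ} (hb0 : 0 ≤ b) (hb : ∀ ε ∈ Icc ε₁ ε₂, ∀ U e, ‖g ε U e‖ ≤ b)
    (η : Measure ℝ) [IsProbabilityMeasure η] (hη : η (Icc ε₁ ε₂) ≠ 0) :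
    Kernel.Invariant (u1JitterHMCL measurable_id hg κ (fun U : GaugeConfig d L Circle => β * wilsonAction ρ U)
        (N := fun _ => n) measurable_const η) (wilsonMeasure (d := d) (L := L) ρ β) ∧
      ∃ ε' : ℝ≥0∞, 0 < ε' ∧ ε' ≤ 1 ∧ ∀ U : GaugeConfig d L Circle,
        ε' • Measure.pi (fun _ : Edge d L => haarProbability Circle) ≤
          u1JitterHMCL measurable_id hg κ (fun U : GaugeConfig d L Circle => β * wilsonAction ρ U)
            (N := fun _ => n) measurable_const η U := by
  haveI : Fact (0 < κ) := ⟨hκ⟩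
  obtain ⟨s, hs⟩ := exists_bound_smul_wilsonAction_circle (d := d) (L := L) ρ hρ β
  have hS : Measurable fun U : GaugeConfig d L Circle => β * wilsonAction ρ U :=
    (continuous_smul_wilsonAction ρ hρ β).measurable
  obtain ⟨δ, hδ0, hmin⟩ := u1LeapfrogHMCN_minorised_uniform hε₁ h12 hκ hn (fun ε => measurable_slice_of_uncurry hg ε)
    hgK hshort hb0 hb hS hs
  haveI := isMarkovKernel_u1JitterHMCL (hε := measurable_id) (hg := hg) (N := fun _ => n) (hN := measurable_const)
    (η := η) hκ hS
  have hmin' : ∀ U : GaugeConfig d L Circle, (η (Icc ε₁ ε₂) * δ) • Measure.pi (fun _ : Edge d L => haarProbability Circle) ≤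
      u1JitterHMCL measurable_id hg κ (fun U : GaugeConfig d L Circle => β * wilsonAction ρ U)
        (N := fun _ => n) measurable_const η U := fun U => by
    rw [← smul_smul]
    exact smul_le_u1JitterHMCL_of_minorant hS measurableSet_Icc (fun ε hε V => hmin ε hε V) U
  have hle1 : η (Icc ε₁ ε₂) * δ ≤ 1 := by
    have h := Measure.le_iff'.1 (hmin' fun _ => 1) univ
    rwa [Measure.smul_apply, smul_eq_mul, measure_univ, measure_univ, mul_one] at h
  exact ⟨wilson_u1JitterHMCL_invariant ρ hρ β hκ n hg η, η (Icc ε₁ ε₂) * δ,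
    ENNReal.mul_pos hη hδ0.ne', hle1, hmin'⟩

/-- **CONVERGENCE FROM EVERY START + UNIQUENESS WHENEVER THE LAW OF THE STEP CHARGES A SHORT WINDOW** (same
hypotheses): for some `0 < r ≤ 1`, `|μ₀ K_jitᵗ(A) − π(A)| ≤ (1 − r)^t` for EVERY initial law `μ₀`, every `t`, every `A`,
`π = wilsonMeasure ρ β`, and `π` is the unique invariant probability law.  No atom of `η` is needed. -/
theorem wilson_u1JitterHMCL_uniformlyErgodic [NeZero L] (hρ : Continuous ρ) (β : ℝ) {ε₁ ε₂ κ : ℝ}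
    (hε₁ : 0 < ε₁) (h12 : ε₁ ≤ ε₂) (hκ : 0 < κ) {n : ℕ} (hn : 1 ≤ n)
    {g : ℝ → GaugeConfig d L Circle → Edge d L → ℝ} (hg : Measurable fun q : ℝ × GaugeConfig d L Circle => g q.1 q.2)
    {K : ℝ≥0} (hgK : ∀ ε ∈ Icc ε₁ ε₂, LipschitzWith K (g ε)) (hshort : 4 * (K : ℝ) * ε₂ * (n : ℝ) ^ 2 ≤ 3)
    {b : ℝ} (hb0 : 0 ≤ b) (hb : ∀ ε ∈ Icc ε₁ ε₂, ∀ U e, ‖g ε U e‖ ≤ b)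
    (η : Measure ℝ) [IsProbabilityMeasure η] (hη : η (Icc ε₁ ε₂) ≠ 0) :
    ∃ r : ℝ, 0 < r ∧ r ≤ 1 ∧
      (∀ (μ₀ : Measure (GaugeConfig d L Circle)) [IsProbabilityMeasure μ₀] (t : ℕ) (A : Set (GaugeConfig d L Circle)),
        |((fun m : Measure (GaugeConfig d L Circle) => m.bind
            (u1JitterHMCL measurable_id hg κ (fun U : GaugeConfig d L Circle => β * wilsonAction ρ U)
              (N := fun _ => n) measurable_const η))^[t] μ₀).real A - (wilsonMeasure (d := d) (L := L) ρ β).real A|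
          ≤ (1 - r) ^ t) ∧
      ∀ (π' : Measure (GaugeConfig d L Circle)) [IsProbabilityMeasure π'],
        Kernel.Invariant (u1JitterHMCL measurable_id hg κ (fun U : GaugeConfig d L Circle => β * wilsonAction ρ U)
          (N := fun _ => n) measurable_const η) π' → π' = wilsonMeasure (d := d) (L := L) ρ β := by
  haveI : Fact (0 < κ) := ⟨hκ⟩
  haveI := isProbabilityMeasure_wilsonMeasure (d := d) (L := L) ρ hρ β
  obtain ⟨hinv, ε', hε0, hε1, hmin⟩ :=
    wilson_u1JitterHMCL_certificate ρ hρ β hε₁ h12 hκ hn hg hgK hshort hb0 hb η hη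
  have hS : Measurable fun U : GaugeConfig d L Circle => β * wilsonAction ρ U :=
    (continuous_smul_wilsonAction ρ hρ β).measurable
  haveI := isMarkovKernel_u1JitterHMCL (hε := measurable_id) (hg := hg) (N := fun _ => n) (hN := measurable_const)
    (η := η) hκ hS
  have hmin1 : ∀ U, ε' • Measure.pi (fun _ : Edge d L => haarProbability Circle) ≤
      nHit (u1JitterHMCL measurable_id hg κ (fun U : GaugeConfig d L Circle => β * wilsonAction ρ U)
        (N := fun _ => n) measurable_const η) (0 + 1) U := fun U => by
    rw [zero_add, GeneralNCMC.nHit_one]; exact hmin U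
  have htop : ε' ≠ ⊤ := ne_top_of_le_ne_top ENNReal.one_ne_top hε1
  refine ⟨ε'.toReal, ENNReal.toReal_pos hε0.ne' htop,
    ENNReal.toReal_le_of_le_ofReal zero_le_one (by rwa [ENNReal.ofReal_one]), fun μ₀ _ t A => ?_, fun π' _ hπ' => ?_⟩
  · simpa only [zero_add, Nat.div_one] using uniformlyErgodic_of_nHit_minorised hmin1 hinv μ₀ t A
  · haveI : IsMarkovKernel (nHit (u1JitterHMCL measurable_id hg κ
        (fun U : GaugeConfig d L Circle => β * wilsonAction ρ U) (N := fun _ => n) measurable_const η) (0 + 1)) :=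
      isMarkovKernel_nHit _ _
    exact invariant_unique_of_minorised hmin1 hε0 (invariant_nHit hinv _) (invariant_nHit hπ' _)

/-- **THE `τ_int` BOUND OF EVERY EVENT** (same hypotheses): some `B ≥ 0` with `τ_int(1_A) ≤ 1/2 + B/(1 − π(A))` for
every measurable `A` with `0 < π(A) < 1`, `π = wilsonMeasure ρ β`. -/
theorem wilson_u1JitterHMCL_tauInt_setACF_le [NeZero L] (hρ : Continuous ρ) (β : ℝ) {ε₁ ε₂ κ : ℝ}
    (hε₁ : 0 < ε₁) (h12 : ε₁ ≤ ε₂) (hκ : 0 < κ) {n : ℕ} (hn : 1 ≤ n)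
    {g : ℝ → GaugeConfig d L Circle → Edge d L → ℝ} (hg : Measurable fun q : ℝ × GaugeConfig d L Circle => g q.1 q.2)
    {K : ℝ≥0} (hgK : ∀ ε ∈ Icc ε₁ ε₂, LipschitzWith K (g ε)) (hshort : 4 * (K : ℝ) * ε₂ * (n : ℝ) ^ 2 ≤ 3)
    {b : ℝ} (hb0 : 0 ≤ b) (hb : ∀ ε ∈ Icc ε₁ ε₂, ∀ U e, ‖g ε U e‖ ≤ b)
    (η : Measure ℝ) [IsProbabilityMeasure η] (hη : η (Icc ε₁ ε₂) ≠ 0) :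
    ∃ B : ℝ, 0 ≤ B ∧ ∀ A : Set (GaugeConfig d L Circle), MeasurableSet A →
      0 < (wilsonMeasure (d := d) (L := L) ρ β).real A → (wilsonMeasure (d := d) (L := L) ρ β).real A < 1 →
      Scoring.tauInt (setACF (u1JitterHMCL measurable_id hg κ (fun U : GaugeConfig d L Circle => β * wilsonAction ρ U)
          (N := fun _ => n) measurable_const η) (wilsonMeasure (d := d) (L := L) ρ β) A) ≤
        1 / 2 + B / (1 - (wilsonMeasure (d := d) (L := L) ρ β).real A) := by
  haveI : Fact (0 < κ) := ⟨hκ⟩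
  haveI := isProbabilityMeasure_wilsonMeasure (d := d) (L := L) ρ hρ β
  obtain ⟨hinv, ε', hε0, hε1, hmin⟩ :=
    wilson_u1JitterHMCL_certificate ρ hρ β hε₁ h12 hκ hn hg hgK hshort hb0 hb η hη
  have hS : Measurable fun U : GaugeConfig d L Circle => β * wilsonAction ρ U :=
    (continuous_smul_wilsonAction ρ hρ β).measurable
  haveI := isMarkovKernel_u1JitterHMCL (hε := measurable_id) (hg := hg) (N := fun _ => n) (hN := measurable_const)
    (η := η) hκ hS
  have hmin1 : ∀ U, ε' • Measure.pi (fun _ : Edge d L => haarProbability Circle) ≤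
      nHit (u1JitterHMCL measurable_id hg κ (fun U : GaugeConfig d L Circle => β * wilsonAction ρ U)
        (N := fun _ => n) measurable_const η) 1 U := fun U => by
    rw [GeneralNCMC.nHit_one]; exact hmin U
  refine ⟨(1 : ℝ) / ε'.toReal - 1, by simpa using doeblinConst_nonneg (m := 1) one_pos hε0 hε1, fun A hA h0 h1 => ?_⟩
  have h := GeneralNCMC.tauInt_setACF_le_of_nHit (GeneralNCMC.minorised_setwise hmin1) hε0 hε1 one_pos hinv hA h0 h1
  simpa using h

end Wilson

end Summit.Ventures.LatticeQCDFlow.Exactness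

end
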